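import Mathlib
import HarnessLib

/-!
# ValiantsHypothesis / LacunarySymmetroid — crux `MatrixDescartes` (stmt-ValiantsHypothesis-18050, V1),
# line «osculation-law», rung O2 «DIAGONAL + RANK-ONE letters»: ENGINE part 1b — SECULAR INTERLACING

For fixed `t`, the `b`-polynomial of the class (✓ `OsculationSecular.insertionPoly_diagonal_add_rankOne`, p648657) is the SECULAR polynomial

  `p = ∏_k (X + C g_k) + C M · Σ_k C ω_k · ∏_{k'≠k} (X + C g_k')`

(`g_k` = skeleton values at `t`, `ω_k = w_k w'_k`, `M = t^(d l₀)`).  FORMAT CAVEAT (val-idea-crit-1 g2 VERDICT #75): this is the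
`b`-polynomial at the full-rank splitting `(m, 0)`, where every skeleton factor carries `X₁`; at a splitting `(r, s)` with `s ≥ 1` the
bottom `s` factors are `b`-free and the statements below apply with `n = r` to the top block (the bottom factors multiply `p` by a
`b`-constant).  This file proves:

* `eval_secular_at_neg` — `p(−g_i) = M · ω_i · ∏_{k'≠i} (g_k' − g_i)` (any finite index type): a branch meets a skeleton sheet only
  over a skeleton CROSSING (`g_k' = g_i`) or where `ω_i = 0`;
* `secular_sign` — for sorted distinct skeleton values (`StrictMono g` on `Fin n`) and `ω_k, M > 0`: `(−1)^i · p(−g_i) > 0`;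
* `exists_root_secular_gap` / `exists_root_secular_below` — a root in each gap `(−g_{i+1}, −g_i)` and one below `−g_{n−1}`;
* ★ `card_roots_secular` — `p` has exactly `n` distinct real roots (Cauchy interlacing for the PSD rank-one update of a diagonal
  matrix, in polynomial clothes): the eigen-branches of the class are SIMPLE away from the skeleton crossings.

Honest framing: an engine lemma for a restricted-class rung; no osculation count; `stub_osculationLaw`, `MatrixDescartes`, Conjecture B
OPEN; `VP ≠ VNP` NOT proved.  No definitions, no named facts; Mathlib only.
-/

set_option linter.dupNamespace false

noncomputable section

namespace Summit.ValiantsHypothesis.ValiantsHypothesis.Theorems.LacunarySymmetroidMatrixDescartes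

namespace OsculationSecular

open Polynomial Filter
open scoped BigOperators Topology

/-- **Value of the secular polynomial at a skeleton point.** [folklore] -/
theorem eval_secular_at_neg {ι : Type*} [Fintype ι] [DecidableEq ι] (g ω : ι → ℝ) (M : ℝ) (i : ι) :
    (∏ k, (X + C (g k)) + C M * ∑ k, C (ω k) * ∏ k' ∈ Finset.univ.erase k, (X + C (g k'))).eval (-g i) =
      M * ω i * ∏ k' ∈ Finset.univ.erase i, (g k' - g i) := by
  have hfac : ∀ s : Finset ι, i ∈ s → (∏ k' ∈ s, (X + C (g k'))).eval (-g i) = 0 := by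
    intro s hs
    rw [eval_prod]
    exact Finset.prod_eq_zero hs (by simp)
  rw [eval_add, hfac _ (Finset.mem_univ i), zero_add, eval_mul, eval_C, eval_finsetSum,
    Finset.sum_eq_single i (fun k _ hk => by
      rw [eval_mul, eval_C, hfac _ (Finset.mem_erase.2 ⟨Ne.symm hk, Finset.mem_univ i⟩), mul_zero])
      (fun h => (h (Finset.mem_univ i)).elim),
    eval_mul, eval_C, eval_prod, mul_assoc]
  congr 2
  refine Finset.prod_congr rfl fun k' _ => ?_
  rw [eval_add, eval_X, eval_C]; ring

/-- `univ.erase i = Iio i ∪ Ioi i` on `Fin n`. [folklore] -/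
theorem erase_eq_Iio_union_Ioi {n : ℕ} (i : Fin n) : Finset.univ.erase i = Finset.Iio i ∪ Finset.Ioi i := by
  ext k
  rw [Finset.mem_erase, Finset.mem_union, Finset.mem_Iio, Finset.mem_Ioi]
  constructor
  · intro h; exact lt_or_gt_of_ne h.1
  · rintro (h | h)
    · exact ⟨ne_of_lt h, Finset.mem_univ k⟩
    · exact ⟨ne_of_gt h, Finset.mem_univ k⟩

/-- The complementary product at a sorted skeleton has sign `(−1)^i`. [folklore] -/
theorem sign_prod_erase {n : ℕ} (g : Fin n → ℝ) (hg : StrictMono g) (i : Fin n) :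
    0 < (-1) ^ (i : ℕ) * ∏ k' ∈ Finset.univ.erase i, (g k' - g i) := by
  rw [erase_eq_Iio_union_Ioi, Finset.prod_union (Finset.disjoint_left.2 fun k hk hk' => by
    rw [Finset.mem_Iio] at hk; rw [Finset.mem_Ioi] at hk'; exact lt_asymm hk hk')]
  have h1 : ∏ k' ∈ Finset.Iio i, (g k' - g i) = (-1) ^ (i : ℕ) * ∏ k' ∈ Finset.Iio i, (g i - g k') := by
    rw [← Fin.card_Iio i, ← Finset.prod_const, ← Finset.prod_mul_distrib]
    exact Finset.prod_congr rfl fun k' _ => by ring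
  have hpos1 : 0 < ∏ k' ∈ Finset.Iio i, (g i - g k') :=
    Finset.prod_pos fun k' hk' => sub_pos.2 (hg (Finset.mem_Iio.1 hk'))
  have hpos2 : 0 < ∏ k' ∈ Finset.Ioi i, (g k' - g i) :=
    Finset.prod_pos fun k' hk' => sub_pos.2 (hg (Finset.mem_Ioi.1 hk'))
  rw [h1, ← mul_assoc, ← mul_assoc, ← pow_add, ← two_mul, pow_mul, neg_one_sq, one_pow, one_mul]
  exact mul_pos hpos1 hpos2

/-- **Alternating signs at the skeleton** (`g` sorted, `ω_k > 0`, `M > 0`). [folklore] -/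
theorem secular_sign {n : ℕ} (g : Fin n → ℝ) (hg : StrictMono g) (ω : Fin n → ℝ) (hω : ∀ k, 0 < ω k) (M : ℝ) (hM : 0 < M)
    (i : Fin n) :
    0 < (-1) ^ (i : ℕ) *
      (∏ k, (X + C (g k)) + C M * ∑ k, C (ω k) * ∏ k' ∈ Finset.univ.erase k, (X + C (g k'))).eval (-g i) := by
  rw [eval_secular_at_neg, show (-1 : ℝ) ^ (i : ℕ) * (M * ω i * ∏ k' ∈ Finset.univ.erase i, (g k' - g i)) =
    (M * ω i) * ((-1) ^ (i : ℕ) * ∏ k' ∈ Finset.univ.erase i, (g k' - g i)) by ring]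
  exact mul_pos (mul_pos hM (hω i)) (sign_prod_erase g hg i)

/-- A continuous function with values of opposite signs at `a < b` vanishes in between. [folklore] -/
theorem exists_zero_Ioo_of_mul_neg {f : ℝ → ℝ} (hf : Continuous f) {a b : ℝ} (hab : a < b) (h : f a * f b < 0) :
    ∃ x ∈ Set.Ioo a b, f x = 0 := by
  rcases lt_or_gt_of_ne (show f a ≠ 0 from fun h0 => by rw [h0, zero_mul] at h; exact lt_irrefl 0 h) with ha | ha
  · have hb : 0 < f b := by nlinarith
    obtain ⟨x, hx, hfx⟩ := intermediate_value_Ioo hab.le hf.continuousOn ⟨ha, hb⟩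
    exact ⟨x, hx, hfx⟩
  · have hb : f b < 0 := by nlinarith
    obtain ⟨x, hx, hfx⟩ := intermediate_value_Ioo' hab.le hf.continuousOn ⟨hb, ha⟩
    exact ⟨x, hx, hfx⟩

/-- **A root in each gap** `(−g_{i+1}, −g_i)`. [folklore] -/
theorem exists_root_secular_gap {n : ℕ} (g : Fin n → ℝ) (hg : StrictMono g) (ω : Fin n → ℝ) (hω : ∀ k, 0 < ω k)
    (M : ℝ) (hM : 0 < M) (i : Fin n) (hi : (i : ℕ) + 1 < n) :
    ∃ x ∈ Set.Ioo (-g ⟨(i : ℕ) + 1, hi⟩) (-g i),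
      (∏ k, (X + C (g k)) + C M * ∑ k, C (ω k) * ∏ k' ∈ Finset.univ.erase k, (X + C (g k'))).eval x = 0 := by
  set p := ∏ k, (X + C (g k)) + C M * ∑ k, C (ω k) * ∏ k' ∈ Finset.univ.erase k, (X + C (g k')) with hp
  set j : Fin n := ⟨(i : ℕ) + 1, hi⟩ with hj
  have hij : i < j := Fin.lt_def.2 (by simp [hj])
  have hgij : -g j < -g i := neg_lt_neg (hg hij)
  have hsi := secular_sign g hg ω hω M hM i
  have hsj := secular_sign g hg ω hω M hM j
  rw [← hp] at hsi hsj
  have hjval : ((j : ℕ) : ℕ) = (i : ℕ) + 1 := rfl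
  rw [hjval, pow_succ] at hsj
  refine exists_zero_Ioo_of_mul_neg p.continuous hgij ?_
  -- signs: (−1)^i p(−g i) > 0 and −(−1)^i p(−g j) > 0
  have hsq : ((-1 : ℝ) ^ (i : ℕ)) ^ 2 = 1 := by rw [← pow_mul, mul_comm, pow_mul, neg_one_sq, one_pow]
  have hprod := mul_pos hsi hsj
  nlinarith [hprod, hsq]

/-- The secular polynomial is monic of degree `n`. [folklore] -/
theorem secular_monic_natDegree {n : ℕ} (g ω : Fin n → ℝ) (M : ℝ) (hn : 0 < n) :
    (∏ k, (X + C (g k)) + C M * ∑ k, C (ω k) * ∏ k' ∈ Finset.univ.erase k, (X + C (g k'))).Monic ∧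
    (∏ k, (X + C (g k)) + C M * ∑ k, C (ω k) * ∏ k' ∈ Finset.univ.erase k, (X + C (g k'))).natDegree = n := by
  classical
  have hP : (∏ k : Fin n, (X + C (g k))).Monic := monic_prod_of_monic _ _ fun k _ => monic_X_add_C (g k)
  have hPdeg : (∏ k : Fin n, (X + C (g k))).natDegree = n := by
    rw [natDegree_prod_of_monic _ _ fun k _ => monic_X_add_C (g k)]
    simp
  have hQdeg : (C M * ∑ k, C (ω k) * ∏ k' ∈ Finset.univ.erase k, (X + C (g k'))).natDegree < n := by
    refine lt_of_le_of_lt (natDegree_C_mul_le _ _) ?_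
    refine lt_of_le_of_lt (natDegree_sum_le_of_forall_le _ _ (n := n - 1) fun k _ => ?_) (by omega)
    refine (natDegree_C_mul_le _ _).trans ?_
    rw [natDegree_prod_of_monic _ _ fun k _ => monic_X_add_C (g k)]
    simp [Finset.card_erase_of_mem]
  have hlt : (C M * ∑ k, C (ω k) * ∏ k' ∈ Finset.univ.erase k, (X + C (g k'))).degree < (∏ k : Fin n, (X + C (g k))).degree := by
    rw [degree_eq_natDegree hP.ne_zero, hPdeg]
    exact lt_of_le_of_lt (degree_le_natDegree) (by exact_mod_cast hQdeg)
  exact ⟨hP.add_of_left hlt, by rw [natDegree_add_eq_left_of_degree_lt hlt, hPdeg]⟩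

/-- **A root below the lowest sheet** `−g_{n−1}`. [folklore] -/
theorem exists_root_secular_below {n : ℕ} (g : Fin n → ℝ) (hg : StrictMono g) (ω : Fin n → ℝ) (hω : ∀ k, 0 < ω k)
    (M : ℝ) (hM : 0 < M) (hn : 0 < n) :
    ∃ x < -g ⟨n - 1, by omega⟩,
      (∏ k, (X + C (g k)) + C M * ∑ k, C (ω k) * ∏ k' ∈ Finset.univ.erase k, (X + C (g k'))).eval x = 0 := by
  set p := ∏ k, (X + C (g k)) + C M * ∑ k, C (ω k) * ∏ k' ∈ Finset.univ.erase k, (X + C (g k')) with hp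
  set l : Fin n := ⟨n - 1, by omega⟩ with hl
  obtain ⟨hmon, hdeg⟩ := secular_monic_natDegree g ω M hn
  rw [← hp] at hmon hdeg
  -- `q(y) = (−1)^n p(−y)` tends to `+∞`
  set q : ℝ[X] := C ((-1 : ℝ) ^ n) * p.comp (-X) with hq
  have hqeval : ∀ y, q.eval y = (-1) ^ n * p.eval (-y) := by
    intro y; rw [hq, eval_mul, eval_C, eval_comp, eval_neg, eval_X]
  have hqdeg : q.natDegree = n := by
    rw [hq, natDegree_C_mul (pow_ne_zero _ (by norm_num)), natDegree_comp, natDegree_neg, natDegree_X, mul_one, hdeg]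
  have hXdeg : (-X : ℝ[X]).natDegree ≠ 0 := by rw [natDegree_neg, natDegree_X]; norm_num
  have hqlead : q.leadingCoeff = 1 := by
    rw [hq, leadingCoeff_mul, leadingCoeff_C, leadingCoeff_comp hXdeg, leadingCoeff_neg, leadingCoeff_X, hmon.leadingCoeff, one_mul,
      hdeg, ← pow_add, ← two_mul, pow_mul, neg_one_sq, one_pow]
  have htend : Tendsto (fun y => q.eval y) atTop atTop :=
    q.tendsto_atTop_of_leadingCoeff_nonneg (by
      rw [degree_eq_natDegree (by rw [← leadingCoeff_ne_zero, hqlead]; norm_num), hqdeg]; exact_mod_cast hn) (by rw [hqlead]; norm_num)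
  obtain ⟨y₀, hy₀⟩ := (htend.eventually (eventually_gt_atTop 0)).exists_forall_of_atTop
  set y := max y₀ (g l + 1) with hy
  have hqy : 0 < q.eval y := hy₀ y (le_max_left _ _)
  have hyl : -y < -g l := by
    have : g l + 1 ≤ y := le_max_right _ _
    linarith
  -- signs at −y and at −g l are opposite: (−1)^n p(−y) > 0 and (−1)^(n−1) p(−g l) > 0
  have hsl := secular_sign g hg ω hω M hM l
  rw [← hp] at hsl
  have hlval : ((l : ℕ) : ℕ) = n - 1 := rfl
  rw [hlval] at hsl
  rw [hqeval] at hqy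
  have hpow : (-1 : ℝ) ^ n = -((-1) ^ (n - 1)) := by
    conv_lhs => rw [show n = (n - 1) + 1 by omega, pow_succ]
    ring
  rw [hpow] at hqy
  have hsq : ((-1 : ℝ) ^ (n - 1)) ^ 2 = 1 := by rw [← pow_mul, mul_comm, pow_mul, neg_one_sq, one_pow]
  have hprod := mul_pos hsl hqy
  obtain ⟨x, hx, hpx⟩ := exists_zero_Ioo_of_mul_neg p.continuous hyl (by nlinarith [hprod, hsq])
  exact ⟨x, hx.2, hpx⟩

/-- ★ **Secular interlacing**: the secular polynomial of a sorted skeleton with positive weights has EXACTLY `n` distinct real roots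
(one in each gap between consecutive skeleton points `−g_{i+1} < −g_i`, and one below `−g_{n−1}`). [folklore] -/
theorem card_roots_secular {n : ℕ} (g : Fin n → ℝ) (hg : StrictMono g) (ω : Fin n → ℝ) (hω : ∀ k, 0 < ω k)
    (M : ℝ) (hM : 0 < M) :
    (∏ k, (X + C (g k)) + C M * ∑ k, C (ω k) * ∏ k' ∈ Finset.univ.erase k, (X + C (g k'))).roots.toFinset.card = n := by
  classical
  rcases Nat.eq_zero_or_pos n with hn0 | hn
  · subst hn0
    have : (∏ k : Fin 0, (X + C (g k)) + C M * ∑ k : Fin 0, C (ω k) * ∏ k' ∈ Finset.univ.erase k, (X + C (g k'))) = 1 := by simp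
    rw [this, roots_one]; rfl
  set p := ∏ k, (X + C (g k)) + C M * ∑ k, C (ω k) * ∏ k' ∈ Finset.univ.erase k, (X + C (g k')) with hp
  obtain ⟨hmon, hdeg⟩ := secular_monic_natDegree g ω M hn
  rw [← hp] at hmon hdeg
  have hp0 : p ≠ 0 := hmon.ne_zero
  -- upper bound
  have hle : p.roots.toFinset.card ≤ n := by
    calc p.roots.toFinset.card ≤ Multiset.card p.roots := Multiset.toFinset_card_le _
      _ ≤ p.natDegree := card_roots' p
      _ = n := hdeg
  -- lower bound: one root per window, windows pairwise disjoint
  -- window i: (−g (i+1), −g i) for i+1 < n, and (−∞, −g (n−1)) for i = n−1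
  have hroot : ∀ i : Fin n, ∃ x : ℝ, p.eval x = 0 ∧ x < -g i ∧ (∀ (h : (i : ℕ) + 1 < n), -g ⟨(i : ℕ) + 1, h⟩ < x) := by
    intro i
    by_cases hi : (i : ℕ) + 1 < n
    · obtain ⟨x, hx, hpx⟩ := exists_root_secular_gap g hg ω hω M hM i hi
      exact ⟨x, hpx, hx.2, fun _ => hx.1⟩
    · have hil : i = ⟨n - 1, by omega⟩ := Fin.ext (by simp; omega)
      obtain ⟨x, hx, hpx⟩ := exists_root_secular_below g hg ω hω M hM hn
      exact ⟨x, hpx, by rw [hil]; exact hx, fun h => (hi h).elim⟩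
  choose x hx using hroot
  have hinj : Function.Injective x := by
    intro i j hij
    by_contra hne
    rcases lt_or_gt_of_ne hne with h | h
    · -- i < j: x j < −g j ≤ −g (i+1) < x i
      have hi1 : (i : ℕ) + 1 < n := lt_of_le_of_lt (Nat.succ_le_of_lt (Fin.lt_def.1 h)) j.isLt
      have h1 := (hx i).2.2 hi1
      have h2 := (hx j).2.1
      have h3 : g ⟨(i : ℕ) + 1, hi1⟩ ≤ g j := hg.monotone (Fin.le_iff_val_le_val.2 (Nat.succ_le_of_lt (Fin.lt_def.1 h)))
      rw [hij] at h1
      linarith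
    · have hj1 : (j : ℕ) + 1 < n := lt_of_le_of_lt (Nat.succ_le_of_lt (Fin.lt_def.1 h)) i.isLt
      have h1 := (hx j).2.2 hj1
      have h2 := (hx i).2.1
      have h3 : g ⟨(j : ℕ) + 1, hj1⟩ ≤ g i := hg.monotone (Fin.le_iff_val_le_val.2 (Nat.succ_le_of_lt (Fin.lt_def.1 h)))
      rw [← hij] at h1
      linarith
  have hge : n ≤ p.roots.toFinset.card := by
    calc n = (Finset.univ.image x).card := by
          rw [Finset.card_image_of_injective _ hinj, Finset.card_univ, Fintype.card_fin]
      _ ≤ p.roots.toFinset.card := by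
          refine Finset.card_le_card fun y hy => ?_
          obtain ⟨i, -, rfl⟩ := Finset.mem_image.1 hy
          rw [Multiset.mem_toFinset, mem_roots hp0]
          exact (hx i).1
  exact le_antisymm hle hge

end OsculationSecular

end Summit.ValiantsHypothesis.ValiantsHypothesis.Theorems.LacunarySymmetroidMatrixDescartes

end
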